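import Literature.AnabelianGeometry.EtaleTheta.Thm56SubdagStatementsGalois
import Literature.AnabelianGeometry.EtaleTheta.Thm56SubdagProofs
import HarnessLib

/-!
# [EtTh] Prop. 5.5 (existence ∧ uniqueness) and Thm. 5.6 (i) sub-DAG assembly ON THE v2 SUBQUOTIENT RECORD `ThetaSubquotientProjGalois`
# (surjective at Galois objects only; proof-only)

Mochizuki, *The étale theta function and its Frobenioid-theoretic manifestations*, Publ. RIMS **45** (2009), Prop. 5.5 pp. 327–328 (PDF
pp. 101–102), Thm. 5.6 pp. 328–329 (PDF pp. 102–103) [cite: MochizukiEtTh2009, Prop 5.5 p.327 (PDF p.101)]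
[cite: MochizukiEtTh2009, Thm 5.6 p.328 (PDF p.102)].

abc-iut cell, layer L2, seat abc-iut-w6-d079 (gen 6), row «PROJ-SURJ-PLAN-A» sequel «(w1f)».  PROOF-ONLY (0 definitions).  The Prop. 5.5 /
Thm. 5.6 (i) assembly of abc-iut-L2-t11 (`Discharge/Sec5RigidityGlue`: uniqueness on `B_N`, Prop. 5.5 modulo existence) and abc-iut-w5-d020
(`Thm56SubdagProofs`: `cyclotomicRigidity_of_sub`, `transportAtBN_of`, `cyclotomicRigidityPreserved_of_sub`) binds abc-iut-L2-t4's v1 record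
`(P : ThetaSubquotientProj 𝔉)` — EMPTY at abc-iut-L2-t9's carrier over the root model (p476337), so those theorems quantify over nothing there.
Here the SAME proofs are re-run VERBATIM on abc-iut-w6-d079's v2 record `(P : ThetaSubquotientProjGalois 𝔉 Gal)` (p481123; INHABITED at every
`ofSetting` carrier, p481568), with the `P`-typed input predicates read through their v2 twins (`Thm56SubdagStatementsGalois.lean`:
`EtaTautologicalGal`, `UnitsCentralUnderLDeltaGal`, `DeltaTransportCompatGal`, `LDeltaCoveredGal`, `ThetaSubquotientProjGalois.IsKummerDetermined`,
`ThetaSubquotientProjGalois.CyclotomicRigidity`); the `P`-free inputs (`BijectivelyReachableFromBN`, `TransportIndependent`, the transport laws,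
`StrvTransport`, …) and the `P`-free producers (`rigidityFamily_exists_of`, `rigidityFamily_unique_of`, `cyclotomicRigidityPreserved_of`,
`psiAut_biKummerDiff`, …) are consumed BY NAME.  Nothing landed is edited; the v1 theorems are the `P.toGalois` instances of these.

* `rigidityFamily_eq_on_BN_of_isKummerDetermined_galois`, `cyclotomicRigidity_unique_of_galois`, `cyclotomicRigidity_of_galois` (↔ abc-iut-L2-t11);
* **`Thm56Sub.cyclotomicRigidity_of_sub_galois`** — Prop. 5.5 (existence ∧ uniqueness, v2 statement) modulo the sub-DAG inputs;
* **`Thm56Sub.transportAtBN_of_galois`**, **`Thm56Sub.cyclotomicRigidityPreserved_of_sub_galois`** — Thm. 5.6 (i) (abc-iut-L2-t4's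
  `CyclotomicRigidityPreserved Ψ ρ aΨ`, a `P`-free conclusion) modulo the sub-DAG inputs read on the v2 record.

HONEST FRAMING: kernel-checked implications between the cell's typed statements; nothing asserts that such data exist for an actual curve;
[EtTh] is refereed; nothing here bears on [IUTchIII] Cor. 3.12 — no side taken; typed ≠ proved.
-/

namespace Literature.AnabelianGeometry.EtaleTheta

open CategoryTheory
open FrobenioidCyclotomicRigidity
open Literature.AlgebraicGeometry.Frobenioids

universe w v v' u u'

namespace ThetaFrobenioid

section Glue

variable {C : Type u} [Category.{v} C] {D : Type u'} [Category.{v'} D]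
  (𝔉 : ThetaFrobenioid.{w} C D) {Gal : D → Prop}

/-- (v2 record; abc-iut-L2-t11's `rigidityFamily_eq_on_BN_of_isKummerDetermined` VERBATIM.) **Prop. 5.5, "determines an isomorphism" is single-valued on `B_N`**: two candidate rigidity
families that are both Kummer-determined on `B_N` (abc-iut-L2-t4's `IsKummerDetermined`: on the part of
`H_{B_N}` over `(l·Δ_Θ)_{B_N}` they are read off from `h ↦ s^⊓-gp_N(h) · s^⊔-gp_N(h)⁻¹`) agree on
`B_N`, provided that part of `H_{B_N}` maps ONTO `(l·Δ_Θ)_{B_N} ⊗ ℤ/Nℤ` (`hcov`; in print `Δ_Θ` is a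
quotient of `Π^tp_Ÿ`, §1 p.12 (PRIMS p.238)).  [cite: MochizukiEtTh2009, Prop 5.5 p.101 (PRIMS p.327)] -/
theorem rigidityFamily_eq_on_BN_of_isKummerDetermined_galois (P : ThetaSubquotientProjGalois 𝔉 Gal)
    (hB : 𝔉.IsThetaSaturated 𝔉.BN)
    (hcov : ∀ x : 𝔉.lDeltaModN 𝔉.BN, ∃ (h : 𝔉.HB)
      (hh : (h : Aut (𝔉.base.obj 𝔉.BN)) ∈ P.pre (𝔉.base.obj 𝔉.BN)),
      (QuotientGroup.mk (P.proj _ ⟨h, hh⟩) : 𝔉.lDeltaModN 𝔉.BN) = x)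
    {ρ ρ' : RigidityFamily 𝔉} (hρ : P.IsKummerDetermined ρ hB)
    (hρ' : P.IsKummerDetermined ρ' hB) : ρ 𝔉.BN hB = ρ' 𝔉.BN hB := by
  apply MulEquiv.ext
  intro x
  obtain ⟨h, hh, rfl⟩ := hcov x
  apply Subtype.ext
  rw [hρ h hh, hρ' h hh]

/-- (v2 record; abc-iut-L2-t11's `cyclotomicRigidity_unique_of` VERBATIM.) **Prop. 5.5, uniqueness half DISCHARGED MODULO** abc-iut-L2-t4's transport step
`LinearlyReachableFromBN` (proof p.102 (PRIMS p.328): every theta-saturated `S` receives a linear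
morphism from `B_N` inducing isomorphisms on `(l·Δ_Θ) ⊗ ℤ/Nℤ` and `μ_N`) and the coverage hypothesis:
"this isomorphism is … independent of the choice of `S''`, `S'''`, and the linear morphisms … precisely
because of the original 'functoriality'".  Combines `rigidityFamily_eq_on_BN_of_isKummerDetermined_galois`
with abc-iut-L2-t4's `rigidityFamily_unique_of`.  [cite: MochizukiEtTh2009, Prop 5.5 p.101 (PRIMS p.327)] -/
theorem cyclotomicRigidity_unique_of_galois (P : ThetaSubquotientProjGalois 𝔉 Gal) (hB : 𝔉.IsThetaSaturated 𝔉.BN)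
    (hreach : LinearlyReachableFromBN 𝔉)
    (hcov : ∀ x : 𝔉.lDeltaModN 𝔉.BN, ∃ (h : 𝔉.HB)
      (hh : (h : Aut (𝔉.base.obj 𝔉.BN)) ∈ P.pre (𝔉.base.obj 𝔉.BN)),
      (QuotientGroup.mk (P.proj _ ⟨h, hh⟩) : 𝔉.lDeltaModN 𝔉.BN) = x)
    (ρ ρ' : RigidityFamily 𝔉) (hK : P.IsKummerDetermined ρ hB) (hF : IsFunctorialLinear 𝔉 ρ)
    (hK' : P.IsKummerDetermined ρ' hB) (hF' : IsFunctorialLinear 𝔉 ρ') : ρ = ρ' :=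
  rigidityFamily_unique_of 𝔉 hreach hB hF hF'
    (𝔉.rigidityFamily_eq_on_BN_of_isKummerDetermined_galois P hB hcov hK hK')

/-- (v2 record; abc-iut-L2-t11's `cyclotomicRigidity_of` VERBATIM, concluding the v2 statement `ThetaSubquotientProjGalois.CyclotomicRigidity`.)
**[EtTh] Proposition 5.5 (Frobenioid-theoretic Cyclotomic Rigidity) DISCHARGED MODULO its existence half** (abc-iut-L2-t4's `CyclotomicRigidity` = existence ∧ uniqueness): given SOME rigidity
family that is Kummer-determined on `B_N` and functorial for linear morphisms (the existence half:
"it follows from the detailed description of the 'étale theta class' in Proposition 1.3 that the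
resulting Kummer class … determines an isomorphism", proof pp.101–102 (PRIMS pp.327–328) — geometric
input, NOT proved here), the transport step and coverage, Prop. 5.5 holds.
[cite: MochizukiEtTh2009, Prop 5.5 p.101 (PRIMS p.327)] -/
theorem cyclotomicRigidity_of_galois (P : ThetaSubquotientProjGalois 𝔉 Gal) (hB : 𝔉.IsThetaSaturated 𝔉.BN)
    (hreach : LinearlyReachableFromBN 𝔉)
    (hcov : ∀ x : 𝔉.lDeltaModN 𝔉.BN, ∃ (h : 𝔉.HB)
      (hh : (h : Aut (𝔉.base.obj 𝔉.BN)) ∈ P.pre (𝔉.base.obj 𝔉.BN)),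
      (QuotientGroup.mk (P.proj _ ⟨h, hh⟩) : 𝔉.lDeltaModN 𝔉.BN) = x)
    (hex : ∃ ρ : RigidityFamily 𝔉, P.IsKummerDetermined ρ hB ∧ IsFunctorialLinear 𝔉 ρ) :
    P.CyclotomicRigidity hB :=
  ⟨hex, 𝔉.cyclotomicRigidity_unique_of_galois P hB hreach hcov⟩


end Glue

namespace Thm56Sub

variable {C : Type u} [Category.{v} C] {D : Type u'} [Category.{v'} D] {𝔉 : ThetaFrobenioid.{w} C D} {Gal : D → Prop}

section PropFiveFive

/-- (v2 record; abc-iut-w5-d020's `cyclotomicRigidity_of_sub` VERBATIM.) **EtTh:Prop5.5 — the v2 statement `P.CyclotomicRigidity hB` (Prop. 5.5, existence ∧ uniqueness) DISCHARGED MODULO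
the sub-DAG inputs**: the Prop. 5.2 (iii) pin `ThetaPairKummerClass η ν` (MERGE-PLAN row 6), `EtaTautologicalGal P η`
(P55-L02), `UnitsCentralUnderLDeltaGal P` (P55-L02b), `BijectivelyReachableFromBN` (P55-L05), `TransportIndependent ν`
(P55-L06), the transport laws (P55-L06b), and abc-iut-L2-t11's coverage `hcov` — by `rigidityFamily_exists_of` +
`isKummerDetermined_of_thetaPair_gal` + abc-iut-L2-t11's `cyclotomicRigidity_of_galois` (uniqueness via abc-iut-L2-t4's
`rigidityFamily_unique_of`).  [cite: MochizukiEtTh2009, Prop 5.5 p.327–328 (PDF pp.101–102)] -/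
theorem cyclotomicRigidity_of_sub_galois (P : ThetaSubquotientProjGalois 𝔉 Gal) (hB : 𝔉.IsThetaSaturated 𝔉.BN)
    {η : 𝔉.HB → 𝔉.lDeltaModN 𝔉.BN} {ν : 𝔉.lDeltaModN 𝔉.BN ≃* 𝔉.muTorsion 𝔉.BN 𝔉.N}
    (hK : FrobenioidThetaBiKummer.ThetaPairKummerClass 𝔉 η ν) (hη : EtaTautologicalGal 𝔉 P η)
    (hcentral : UnitsCentralUnderLDeltaGal 𝔉 P) (hreach : BijectivelyReachableFromBN 𝔉)
    (hind : TransportIndependent 𝔉 ν) (hUc : UnitsPullComp 𝔉) (hUi : UnitsPullId 𝔉) (hLc : LDeltaMapComp 𝔉)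
    (hLi : LDeltaMapId 𝔉) (hcov : LDeltaCoveredGal 𝔉 P) : P.CyclotomicRigidity hB := by
  obtain ⟨ρ, hρB, hρ⟩ := rigidityFamily_exists_of hB ν hreach hind hUc hUi hLc hLi
  have hreach' : LinearlyReachableFromBN 𝔉 := fun S hS => by
    obtain ⟨φ, hφ, hΔ, hμ⟩ := hreach S hS
    exact ⟨φ, hφ, hΔ.2, hμ.1⟩
  exact 𝔉.cyclotomicRigidity_of_galois P hB hreach' hcov
    ⟨ρ, isKummerDetermined_of_thetaPair_gal 𝔉 P hK hη (cyclotomeCentral_of_unitsCentral_gal 𝔉 hcentral) ρ hB hρB, hρ⟩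


end PropFiveFive

section TransportAtBN

variable (Ψ : C ≌ C) (α : Ψ.functor.obj 𝔉.AN ≅ 𝔉.AN) (β : Ψ.functor.obj 𝔉.BN ≅ 𝔉.BN) (e : 𝔉.AN ≅ 𝔉.AN)
  (Dp : Aut 𝔉.BN) (θ : Aut (𝔉.base.obj 𝔉.BN) ≃* Aut (𝔉.base.obj 𝔉.BN))

/-- (v2 record; abc-iut-w5-d020's `transportAtBN_of` VERBATIM.) **EtTh:Thm5.6(i)/T56-L09 — the transport of the rigidity isomorphism at `S₂ = B_N`, DERIVED** (p.329 (PDF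
p.103) l.17–23: «by forming the resulting group homomorphisms … [Prop. 4.3 (i)] and Kummer classes [Prop. 4.3
(iii)], and observing that the Kummer class of the "constant function" `u` does not affect the restriction of the
resulting Kummer classes to `(l·Δ_Θ)_{S₂}`, `(l·Δ_Θ)_{T₂}`, we conclude that `Ψ` does indeed transport the natural
isomorphism `(l·Δ_Θ)_{S₂} ⊗ ℤ/Nℤ ⥲ μ_N(S₂)` of Proposition 5.5 to the corresponding isomorphism for `T₂`»).  This is
EXACTLY abc-iut-L2-d4's binder `hBN` of `Discharge/Sec5Thm56.preservesRigidityIso_of` /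
`cyclotomicRigidityPreserved_of`.  Inputs, as printed: the transport of the root up to the unit `u = D_p` (abc-iut-L2-d4
T1 `Discharge/Sec5Thm57.exists_codTransport_of_div_eq`, normalised to `D_c = 1` by re-choosing `β` — «`γ₂ ∘ s′ = t′
∘ γ₁`, `u ∘ γ₂ ∘ s″ = t″ ∘ γ₁`»: `hT`, `hT'`, `hu`), the transport of `s^trv_N` over `θ` (abc-iut-L2-t4 `StrvTransport`,
Thm. 4.4 (iv): `hstrv`) with `θ(H_{B_N}) = H_{B_N}` (Prop. 2.4: `hYdd`), the defining relations of the bi-Kummer root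
and total epimorphicity (`hcap`, `hcup`, `Epi`), Prop. 4.3 (iii) (`hdiff`), the T56-L09b/c/d inputs, and for the
family `ρ`: Kummer-determined on `B_N` (Prop. 5.5), functorial for linear morphisms (at the isomorphism `β`), coverage.
The computation is abc-iut-L2-d4's `psiAut_biKummerDiff` (Discharge/Sec5Thm57Kummer) with the Kummer cocycle of `u`
killed on the `Δ`-part by T56-L09b.  [cite: MochizukiEtTh2009, Thm 5.6 proof p.329 (PDF p.103)] -/
theorem transportAtBN_of_galois [Epi 𝔉.sCap] [Epi 𝔉.sCup] (hcap : 𝔉.SgpCapSpec) (hcup : 𝔉.SgpCupSpec)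
    (hdiff : 𝔉.BiKummerDifferenceMem)
    (hT : α.inv ≫ Ψ.functor.map 𝔉.sCap ≫ β.hom = e.hom ≫ 𝔉.sCap ≫ (1 : Aut 𝔉.BN).hom)
    (hT' : α.inv ≫ Ψ.functor.map 𝔉.sCup ≫ β.hom = e.hom ≫ 𝔉.sCup ≫ Dp.hom) (hu : Dp ∈ 𝔉.units 𝔉.BN)
    (hstrv : 𝔉.StrvTransport Ψ α e θ) (hYdd : 𝔉.HB.map θ.toMonoidHom = 𝔉.HB)
    (P : ThetaSubquotientProjGalois 𝔉 Gal) (hcentral : UnitsCentralUnderLDeltaGal 𝔉 P) (hspec : UnitsPullSpec 𝔉)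
    (aΨ : ∀ S : C, 𝔉.lDeltaModN S ≃* 𝔉.lDeltaModN (Ψ.functor.obj S))
    (hcompat : DeltaTransportCompatGal 𝔉 Ψ β aΨ θ P)
    (ρ : RigidityFamily 𝔉) (hB : 𝔉.IsThetaSaturated 𝔉.BN) (hK : P.IsKummerDetermined ρ hB)
    (hρ : IsFunctorialLinear 𝔉 ρ) (hcov : LDeltaCoveredGal 𝔉 P)
    (hΨB : 𝔉.IsThetaSaturated (Ψ.functor.obj 𝔉.BN)) (x : 𝔉.lDeltaModN 𝔉.BN) :
    (Ψ.functor.mapAut 𝔉.BN (ρ 𝔉.BN hB x : Aut 𝔉.BN) : Aut (Ψ.functor.obj 𝔉.BN)) =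
      ρ (Ψ.functor.obj 𝔉.BN) hΨB (aΨ 𝔉.BN x) := by
  -- write `x = [proj h]` for some `h ∈ H_{B_N}` over `(l·Δ_Θ)_{B_N}` (coverage)
  obtain ⟨h, hh, rfl⟩ := hcov x
  -- `θ h ∈ H_{B_N}` (Prop. 2.4) and `θ h` lies over `(l·Δ_Θ)_{B_N}` again, compatibly with `aΨ` (T56-L09c)
  have hθmem : θ (h : Aut (𝔉.base.obj 𝔉.BN)) ∈ 𝔉.HB := (mem_iff_of_map_equiv_eq hYdd _).mpr h.2
  obtain ⟨hθpre, hθeq⟩ := hcompat (h : Aut (𝔉.base.obj 𝔉.BN)) hh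
  set h₁ : 𝔉.HB := ⟨θ (h : Aut (𝔉.base.obj 𝔉.BN)), hθmem⟩ with hh₁
  have hθpre₁ : (h₁ : Aut (𝔉.base.obj 𝔉.BN)) ∈ P.pre (𝔉.base.obj 𝔉.BN) := hθpre
  have hθeq₁ : 𝔉.lDeltaModNMap β.hom (aΨ 𝔉.BN (QuotientGroup.mk (P.proj _ ⟨(h : Aut (𝔉.base.obj 𝔉.BN)), hh⟩)))
      = QuotientGroup.mk (P.proj _ ⟨(h₁ : Aut (𝔉.base.obj 𝔉.BN)), hθpre₁⟩) := hθeq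
  -- abc-iut-L2-d4's transport of the bi-Kummer difference (with `D_c = 1`), the Kummer cocycle of the
  -- unit `u = D_p` being trivial on the `Δ`-part (T56-L09b)
  have hbi := psiAut_biKummerDiff Ψ α β e (1 : Aut 𝔉.BN) Dp θ hcap hcup hT hT' hstrv hYdd h
  simp only [inv_one, one_mul, mul_one] at hbi
  have hbi₁ : 𝔉.psiAut Ψ β (𝔉.sgpCap (h : Aut (𝔉.base.obj 𝔉.BN)) * (𝔉.sgpCup h)⁻¹) =
      𝔉.sgpCap (h₁ : Aut (𝔉.base.obj 𝔉.BN)) * (𝔉.sgpCup h₁)⁻¹ *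
        (𝔉.sgpCup h₁ * Dp * (𝔉.sgpCup h₁)⁻¹ * Dp⁻¹) := hbi
  rw [sgpCup_comm_units_of_gal 𝔉 hcentral hdiff h₁ hθpre₁ hu, mul_inv_cancel_right, mul_inv_cancel, mul_one]
    at hbi₁
  -- `ρ_{B_N}` at `h` and at `θ h` IS the bi-Kummer difference (Prop. 5.5, Kummer-determined on `B_N`)
  have hKh := hK h hh
  have hKθ := hK h₁ hθpre₁
  -- the right-hand side through the functoriality of `ρ` at the (linear) isomorphism `β` and T56-L09c
  have hfun := hρ β.hom (isLinear_iso_hom β) hΨB hB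
    (aΨ 𝔉.BN (QuotientGroup.mk (P.proj _ ⟨(h : Aut (𝔉.base.obj 𝔉.BN)), hh⟩)))
  rw [hθeq₁] at hfun
  rw [← hfun]
  -- compare inside `Aut_C(B_N)` after conjugating by `β` (T56-L09d: the unit pull-back along `β` is conjugation)
  apply β.conjAut.injective
  rw [muTorsionPull_iso_eq 𝔉 hspec β 𝔉.N, hKθ, ← psiAut_eq_conjAut, hKh, hbi₁]


end TransportAtBN

section Assembly

variable (Ψ : C ≌ C) (α : Ψ.functor.obj 𝔉.AN ≅ 𝔉.AN) (β : Ψ.functor.obj 𝔉.BN ≅ 𝔉.BN) (e : 𝔉.AN ≅ 𝔉.AN)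
  (Dp : Aut 𝔉.BN) (θ : Aut (𝔉.base.obj 𝔉.BN) ≃* Aut (𝔉.base.obj 𝔉.BN))

/-- (v2 record; abc-iut-w5-d020's `cyclotomicRigidityPreserved_of_sub` VERBATIM.) **EtTh:Thm5.6(i)/T56-A — [EtTh] Theorem 5.6 (both clauses, abc-iut-L2-t4's `CyclotomicRigidityPreserved Ψ ρ aΨ`),
discharged modulo its cited inputs with the transport at `B_N` (`hBN`) DERIVED.**  Binders = abc-iut-L2-d4's
(`Ψbs`, `eΨ`, `aΨ`+`haΨ`, `hreach`, `hρ`, `hlin`, `hpull`) with `hBN` replaced by the inputs of `transportAtBN_of_galois`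
(root transport with `D_c = 1` and unit `D_p`, `StrvTransport`, `hYdd`, bi-Kummer relations, T56-L09b/c/d,
`IsKummerDetermined`, coverage).  [cite: MochizukiEtTh2009, Thm 5.6 p.328–329 (PDF pp.102–103)] -/
theorem cyclotomicRigidityPreserved_of_sub_galois [Epi 𝔉.sCap] [Epi 𝔉.sCup]
    (Ψbs : D ⥤ D) [Ψbs.Faithful] (eΨ : Ψ.functor ⋙ 𝔉.base ≅ 𝔉.base ⋙ Ψbs)
    (aΨ : ∀ S : C, 𝔉.lDeltaModN S ≃* 𝔉.lDeltaModN (Ψ.functor.obj S))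
    (ρ : RigidityFamily 𝔉) (hB : 𝔉.IsThetaSaturated 𝔉.BN)
    (hreach : LinearlyReachableFromBN 𝔉) (hρ : IsFunctorialLinear 𝔉 ρ)
    (hlin : PreFrobenioidData.PreservesMor Ψ.functor 𝔉.IsLinear 𝔉.IsLinear)
    (haΨ : ∀ {S T : C} (φ : S ⟶ T) (x : 𝔉.lDeltaModN S),
      aΨ T (𝔉.lDeltaModNMap φ x) = 𝔉.lDeltaModNMap (Ψ.functor.map φ) (aΨ S x))
    (hpull : ∀ {S T : C} (φ : S ⟶ T) (u : 𝔉.muTorsion T 𝔉.N)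
      (hu : Ψ.functor.mapAut T (u : Aut T) ∈ 𝔉.muTorsion (Ψ.functor.obj T) 𝔉.N),
      Ψ.functor.mapAut S (𝔉.muTorsionPull φ 𝔉.N u : Aut S) =
        (𝔉.muTorsionPull (Ψ.functor.map φ) 𝔉.N ⟨_, hu⟩ : Aut (Ψ.functor.obj S)))
    (hcap : 𝔉.SgpCapSpec) (hcup : 𝔉.SgpCupSpec) (hdiff : 𝔉.BiKummerDifferenceMem)
    (hT : α.inv ≫ Ψ.functor.map 𝔉.sCap ≫ β.hom = e.hom ≫ 𝔉.sCap ≫ (1 : Aut 𝔉.BN).hom)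
    (hT' : α.inv ≫ Ψ.functor.map 𝔉.sCup ≫ β.hom = e.hom ≫ 𝔉.sCup ≫ Dp.hom) (hu : Dp ∈ 𝔉.units 𝔉.BN)
    (hstrv : 𝔉.StrvTransport Ψ α e θ) (hYdd : 𝔉.HB.map θ.toMonoidHom = 𝔉.HB)
    (P : ThetaSubquotientProjGalois 𝔉 Gal) (hcentral : UnitsCentralUnderLDeltaGal 𝔉 P) (hspec : UnitsPullSpec 𝔉)
    (hcompat : DeltaTransportCompatGal 𝔉 Ψ β aΨ θ P) (hK : P.IsKummerDetermined ρ hB)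
    (hcov : LDeltaCoveredGal 𝔉 P) :
    CyclotomicRigidityPreserved 𝔉 Ψ ρ aΨ :=
  cyclotomicRigidityPreserved_of Ψ Ψbs eΨ aΨ ρ hB hreach hρ hlin haΨ hpull
    (fun hΨB x => transportAtBN_of_galois Ψ α β e Dp θ hcap hcup hdiff hT hT' hu hstrv hYdd P hcentral hspec aΨ
      hcompat ρ hB hK hρ hcov hΨB x)


end Assembly

end Thm56Sub

end ThetaFrobenioid

end Literature.AnabelianGeometry.EtaleTheta
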